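import Summits.Schanuel.Schanuel.Theorems.RootDecomp1KResidueDescent03

/-!
# RootDecomp1KResidueDescent — lens 1, generation 68, NODE 28 «DESCENT INTO THE SECTOR — BOTH RESIDUE EXHIBITS OF RECORD DECIDED» (×0-AS-RECORD, PRICE L3059; ERRATUM E5; CLAIM L3057, NODE L3068, VERDICT L3071): `thinFibreAt_rho1` / `levelFinite_rho1` (no level point at ANY N ≥ 4 — bi-pure gcd descent + the digit mod 32; family `quartC c = Y⁴ + x·Y − c·x²`, c an odd prime ≢ 1 mod 32) and `thinFibreAt_rho2` / `levelFinite_rho2` (descent onto the x-LINEAR auxiliaries `17Y⁴ + Y³ − x`, `Y⁴ + Y³ − 17³·x`, decided by the TREE's `levelFinite_xLinear` ← node 2's `thinFibreAt_xLinear`; family `bisqC c = (Y² − c·x)² − x·Y`), and the typed NOT-BI-PURE nominees `residue_rho1'` / `residue_rho2'` (ρ1′ = Y⁴ + Y³ + x·Y + x − 17x², ρ2′ = (Y² − 17x)² − x·Y − x) — continuation (RootDecomp1KResidueDescent04): # ρ2′ = `(Y² − 17x)² − x·Y − x` — 11 declarations `residue_rho1'` … `nominees`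

(lens-1 g68 NODE 28 «DESCENT INTO THE SECTOR» L3068: HOME kernel K = HOME/decomp-schanuel-lens-1/g68/lean/ResidueDescent.lean sha256 7ab17922…, 1232 l, 74 decls (70 theorems + 4 defs), ONE namespace `Summit.Schanuel.Schanuel.Theorems.RootDecomp1KResidueDescent`, imports the tree port …RootDecomp1KSectorTheorem10 ONLY (node 27's THEOREM ×1 port; `rho1` / `rho2` / `Residue` / `SectorCond` / `exists_fourth_root_seventeen` / `exists_sqrt_seventeen` / `levelFinite_xLinear` / `levelFinite_of_thinFibreAt_zero` BY TREE NAME); no private / instance / set_option / notation / sorry / new axiom / binder, `decide` only on ZMod 32 / small literals; lens farm rc 0 · 0 errors · 0 sorries · 74 dupNamespace, `--axioms` standard on 17 names, Probe g68/out/Probe.lean 9038b768… rc 0, memo g68/NODE-g68.md 3833b29f…; CLAIM L3057 (ASK-FIRST under K-R58 (iii)); crit g12 PRICE L3059: ×0-AS-RECORD («the levers are bi-pure DESCENT ∪ LOCAL SIEVING mod 32 (ρ1) ∪ the EDGE ENGINE BY NAME (ρ2)»), correction e28-pre-1 (the w = 289 auxiliary `Y⁴ + Y³ − 17³·x`, ADOPTED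 by the lens), CHECKLIST K-g68 (D1)–(D5) + (S), ERRATUM E5 PRE-ANNOUNCED (exhibits of record must be typed-Residue AND not toolkit-decided, in particular NOT bi-pure; rho1 / rho2 leave the exhibit list and join the unconditional part; exhibits := ∅ until ρ1′ / ρ2′ are certified); writer g35 pre-check NOTE 1 L3060; census LIVENESS-v38 (key bipure: rho1 / rho2 bi-pure, ρ1′ / ρ2′ not; key edge on the nominees: ρ1 / ρ2 by the recipe); crit g12 VERDICT L3071 (04:51Z): ×0-AS-RECORD BOOKED (CHECKLIST K-g68 (D1)–(D4) + (S) met on the critic's own farm runs; (D5) declined-as-typed, families instead), TALLY UNCHANGED lens-1 ×22 + THEOREM ×24, ERRATUM E5 FIXED (PRICE L3059 (E5-a)–(E5-d) verbatim; instantiation: toolkit ∪= bi-pure descent; rho1 / rho2 leave the exhibit list and join the unconditional part; exhibits of record := ρ1′ / ρ2′ effective at port landing; ledger and non-dominant territory unchanged), W-28-1 (typed (T♭) welcome, ×0), PORT GO → census-1 (this port; PORT IDENTITY 28 owed by the seated critic). Port by census-1 gen 25 as `RootDecomp1KResidueDescent01–04` (files ≤ 400 lines; `--supports stmt-Schanuel-33364`,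 the item stays OPEN; ×0 record port, no credit anywhere; E5: UNCONDITIONAL PART ∪= these names): 01 = K l.1–378 of the prepped source (opens §0 / §1 / §2 / §3) — 20 decls `quartC`, `bisqC`, `rho1_eq_quartC`, …, `int_eq4`; 02 = K l.379–693 of the prepped source (opens §4 / §5 / §6) — 17 decls `shape4`, `level_exponent`, `two_pow_dvd_psNumer_sub_one`, …, `bound_one`; 03 = K l.694–941 of the prepped source (opens # The x-linear input BY TREE NAME: `RootDecomp1KXLinear.thinFibreAt_xLinear` (XLinear05) at quality `0` / # (D2) THE STRATUM-ρ2 EXHIBIT OF RECORD `rho2 = (Y² − 17x)² − x·Y`, DECIDED / # Sanity instance (PRICE L3059): the level-`m = 8` integer point of the ρ2 equation and its descent parameter / §7 / # ρ1′ = `Y⁴ + Y³ + x·Y + x − 17·x²`) — 26 decls `bound_two`, `three_le_abs`, `aeval_aux₁`, …, `rho1'_axisY_two_monomials`; 04 = K l.942–1253 of the prepped source (opens # ρ2′ = `(Y² − 17x)² − x·Y − x`) — 11 decls `residue_rho1'`, `sectorCond_rho1'`, `rho2'`, …, `nominees`. 22 one-line docstrings synthesised for undocumented helper declarations (statements quoted);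 everything else = K VERBATIM (statements, names, proofs, K's module docstring kept in part 01 below this provenance block).)
-/

noncomputable section

namespace Summit.Schanuel.Schanuel.Theorems.RootDecomp1KResidueDescent

open Polynomial LiouvilleNumber
open scoped Nat
open Summit.Schanuel.Schanuel.Theorems.RootDecomp1KTwoBaseCell (psNumer partialSum_eq_psNumer_div coprime_psNumer)
open Summit.Schanuel.Schanuel.Theorems.RootDecomp1KDegreeLadder
open Summit.Schanuel.Schanuel.Theorems.RootDecomp1KXLinear (xLinP bev_xLinP thinFibreAt_xLinear)
open Summit.Schanuel.Schanuel.Theorems.RootDecomp1KXTop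
open Summit.Schanuel.Schanuel.Theorems.RootDecomp1KLevelFinite
open Summit.Schanuel.Schanuel.Theorems.RootDecomp1KOddEmpty (levelFinite_of_no_level)
open Summit.Schanuel.Schanuel.Theorems.RootDecomp1KHeightGrading (BddLevelEmpty bddLevelEmpty_iff_levelFinite)
open Summit.Schanuel.Schanuel.Theorems.RootDecomp1KDigitPincer (odd_psNumer_two two_pow_dvd_of_dvd_mul_odd)
open Summit.Schanuel.Schanuel.Theorems.RootDecomp1KTrinomialDescent (partialSum_two_eq_int_div)
open Summit.Schanuel.Schanuel.Theorems.RootDecomp1KRunge (psNumer_pos_runge)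
open Summit.Schanuel.Schanuel.Theorems.RootDecomp1KLocalExponent (rootMult)
open Summit.Schanuel.Schanuel.Theorems.RootDecomp1KSectorTheorem (Residue SectorCond EdgeGood TopWeight RootGood layerPoly supp
  layerPoly_eq_sum mem_supp_of aeval_eq_eval_map rho1 rho2 rho1_zero rho1_one rho1_two rho2_zero rho2_one rho2_two
  aeval_intCast_padicInt exists_padicInt_root exists_fourth_root_seventeen exists_sqrt_seventeen
  levelFinite_of_thinFibreAt_zero levelFinite_xLinear)

/-- **THE NOMINEE ρ1′ IS A TYPED STRATUM-ρ1 RESIDUE MEMBER at every `m₀ ≤ 2`.**  Layer table of the violating hull pair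
`(c₀, c₂)`: slope `s/q = 2/4`, top weight `M = 8`; support `{(0,4), (0,3), (1,1), (1,0), (2,0)}` with weights
`8, 6, 6, 4, 8`; `f = f₀ = W⁴ − 17`, `f₁ = 0`, `f₂ = W³ + W`, `f₃ = 0`, `f₄ = 1`.  The root `β = 17^{1/4} ∈ ℚ₂` (Hensel) is
non-zero and SIMPLE: (I) fails; (C) needs `L > μ·s ≥ 2`, i.e. `f₂ ≡ 0`: false; (R) needs `L > s = 2`, i.e.
`f₂(β) = β(β² + 1) = 0`, i.e. `β² = −1`, contradicting `β⁴ = 17`.  `G_eff(β) = 2 = s` exactly as for `rho1` — but the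
first correction now comes from TWO monomials (`Y³` and `x·Y`), and `c₀` is not a monomial. -/
theorem residue_rho1' {m₀ : ℕ} (hm : m₀ ≤ 2) : Residue m₀ 2 rho1' := by
  classical
  have hd0 : (rho1' 0).natDegree = 4 := by rw [rho1'_zero]; compute_degree!
  have hd1 : (rho1' 1).natDegree = 1 := by rw [rho1'_one]; compute_degree!
  have hd2 : (rho1' 2).natDegree = 0 := by rw [rho1'_two, natDegree_C]
  have h00 : rho1' 0 ≠ 0 := by intro h; rw [h, natDegree_zero] at hd0; omega
  have h22 : rho1' 2 ≠ 0 := by rw [rho1'_two]; exact (map_ne_zero_iff C C_injective).mpr (by norm_num)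
  intro hS
  have hgood : EdgeGood 2 rho1' 2 4 := by
    have := hS 0 2 (by norm_num) le_rfl h00 h22 (by rw [hd0, hd2]; norm_num) (by rw [hd0, hd2]; omega)
      (by
        intro j hj _
        rw [hd0, hd2]
        interval_cases j
        · rw [hd0]
        · rw [hd1]; norm_num
        · rw [hd2])
    rwa [hd0, hd2] at this
  obtain ⟨M, hT, hroots⟩ := hgood
  have hS' : ∀ p ∈ ({(0, 4), (0, 3), (1, 1), (1, 0), (2, 0)} : Finset (ℕ × ℕ)), p.1 ≤ 2 := by
    intro p hp
    simp only [Finset.mem_insert, Finset.mem_singleton] at hp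
    rcases hp with rfl | rfl | rfl | rfl | rfl <;> norm_num
  have hsupp : ∀ p : ℕ × ℕ, p.1 ≤ 2 → (rho1' p.1).coeff p.2 ≠ 0 →
      p ∈ ({(0, 4), (0, 3), (1, 1), (1, 0), (2, 0)} : Finset (ℕ × ℕ)) := by
    rintro ⟨j, i⟩ hj hc
    dsimp only at hj hc
    simp only [Finset.mem_insert, Finset.mem_singleton, Prod.mk.injEq]
    interval_cases j
    · by_cases h4 : i = 4
      · exact Or.inl ⟨rfl, h4⟩
      by_cases h3 : i = 3
      · exact Or.inr (Or.inl ⟨rfl, h3⟩)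
      exfalso; apply hc
      rw [rho1'_zero, coeff_add, coeff_X_pow, coeff_X_pow, if_neg h4, if_neg h3, add_zero]
    · by_cases h1 : i = 1
      · exact Or.inr (Or.inr (Or.inl ⟨rfl, h1⟩))
      by_cases h0 : i = 0
      · exact Or.inr (Or.inr (Or.inr (Or.inl ⟨rfl, h0⟩)))
      exfalso; apply hc
      rw [rho1'_one, coeff_add, coeff_X, coeff_C, if_neg (Ne.symm h1), if_neg h0, add_zero]
    · rw [rho1'_two, coeff_C] at hc
      split_ifs at hc with h0
      · exact Or.inr (Or.inr (Or.inr (Or.inr ⟨rfl, h0⟩)))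
      · exact (hc rfl).elim
  have h8 : 8 ≤ M := by
    have := hT.1 (0, 4) (mem_supp_of (by norm_num)
      (by rw [rho1'_zero, coeff_add, coeff_X_pow, coeff_X_pow, if_pos rfl]; norm_num))
    omega
  have hM : M = 8 := by
    by_contra hne
    apply hT.2
    rw [layerPoly_eq_sum 2 rho1' _ hS' hsupp, Finset.sum_eq_zero]
    intro p hp
    exfalso
    rw [Finset.mem_filter] at hp
    obtain ⟨hp1, hp2⟩ := hp
    simp only [Finset.mem_insert, Finset.mem_singleton] at hp1
    rcases hp1 with rfl | rfl | rfl | rfl | rfl <;> norm_num at hp2 <;> omega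
  subst hM
  have h04 : (rho1' 0).coeff 4 = 1 := by
    rw [rho1'_zero, coeff_add, coeff_X_pow, coeff_X_pow, if_pos rfl]; norm_num
  have h03 : (rho1' 0).coeff 3 = 1 := by
    rw [rho1'_zero, coeff_add, coeff_X_pow, coeff_X_pow, if_pos rfl]; norm_num
  have h11 : (rho1' 1).coeff 1 = 1 := by rw [rho1'_one, coeff_add, coeff_X, coeff_C, if_pos rfl]; norm_num
  have h20 : (rho1' 2).coeff 0 = -17 := by rw [rho1'_two, coeff_C, if_pos rfl]
  have hf0 : layerPoly 2 rho1' 2 4 8 0 = X ^ 4 + C (-17) := by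
    rw [layerPoly_eq_sum 2 rho1' _ hS' hsupp, Finset.sum_filter, Finset.sum_insert (by decide),
      Finset.sum_insert (by decide), Finset.sum_insert (by decide), Finset.sum_insert (by decide),
      Finset.sum_singleton]
    norm_num [h04, h20]
  have hf2 : layerPoly 2 rho1' 2 4 8 2 = X ^ 3 + X := by
    rw [layerPoly_eq_sum 2 rho1' _ hS' hsupp, Finset.sum_filter, Finset.sum_insert (by decide),
      Finset.sum_insert (by decide), Finset.sum_insert (by decide), Finset.sum_insert (by decide),
      Finset.sum_singleton]
    norm_num [h03, h11]
  -- the root `β = 17^{1/4} ∈ ℚ₂`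
  obtain ⟨y, hy⟩ := exists_fourth_root_seventeen
  have hβ4 : (algebraMap ℚ_[2] (PadicAlgCl 2) y) ^ 4 = 17 := by rw [← map_pow, hy, map_ofNat]
  have hβ0 : algebraMap ℚ_[2] (PadicAlgCl 2) y ≠ 0 := by
    intro h
    rw [h, zero_pow four_ne_zero] at hβ4
    norm_num at hβ4
  have hroot : aeval (algebraMap ℚ_[2] (PadicAlgCl 2) y) (layerPoly 2 rho1' 2 4 8 0) = 0 := by
    rw [hf0, map_add, map_pow, aeval_X, aeval_C, eq_intCast, hβ4]
    norm_num
  rcases hroots _ hβ0 hroot with hirr | ⟨L, hlay, hμL, -⟩ | ⟨-, L, hlay, hsL, -⟩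
  · exact hirr y rfl
  · -- (C): `μ ≥ 1` forces `L ≥ 3`, but `f_2 = W³ + W ≠ 0`
    have hμ : 1 ≤ rootMult (layerPoly 2 rho1' 2 4 8 0) (algebraMap ℚ_[2] (PadicAlgCl 2) y) := by
      unfold rootMult
      refine (rootMultiplicity_pos ?_).mpr ?_
      · exact (Polynomial.map_ne_zero_iff (RingHom.injective_int _)).mpr hT.2
      · rw [IsRoot.def, ← aeval_eq_eval_map]
        exact hroot
    have h0 := hlay 2 (by norm_num) (by omega)
    rw [hf2] at h0
    have := congrArg (eval 1) h0
    norm_num at this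
  · -- (R): `L > s = 2` forces `f_2(β) = β³ + β = 0`, i.e. `β² = −1`, contradicting `β⁴ = 17`
    have h0 := hlay 2 (by norm_num) hsL
    rw [hf2, map_add, map_pow, aeval_X] at h0
    have e1 : (algebraMap ℚ_[2] (PadicAlgCl 2) y) ^ 2 = -17 := by
      linear_combination (algebraMap ℚ_[2] (PadicAlgCl 2) y) * h0 - hβ4
    have e2 : (17 : PadicAlgCl 2) = 289 := by
      rw [← hβ4, show (4 : ℕ) = 2 * 2 by norm_num, pow_mul, e1]; norm_num
    norm_num at e2

/-- at `m₀ ≥ 3` ρ1′ has no violating hull pair: the sector condition holds (vacuously). -/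
theorem sectorCond_rho1' {m₀ : ℕ} (hm : 3 ≤ m₀) : SectorCond m₀ 2 rho1' := by
  have hd0 : (rho1' 0).natDegree = 4 := by rw [rho1'_zero]; compute_degree!
  have hd1 : (rho1' 1).natDegree = 1 := by rw [rho1'_one]; compute_degree!
  have hd2 : (rho1' 2).natDegree = 0 := by rw [rho1'_two, natDegree_C]
  have h22 : rho1' 2 ≠ 0 := by rw [rho1'_two]; exact (map_ne_zero_iff C C_injective).mpr (by norm_num)
  have h00 : rho1' 0 ≠ 0 := by intro h; rw [h, natDegree_zero] at hd0; omega
  intro j₁ j₂ hlt hle h1 h2 hdlt hmv hhull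
  have hj₂ : j₂ = 1 ∨ j₂ = 2 := by omega
  rcases hj₂ with rfl | rfl
  · obtain rfl : j₁ = 0 := by omega
    have := hhull 2 le_rfl h22
    rw [hd0, hd1, hd2] at this
    omega
  · have hj₁ : j₁ = 0 ∨ j₁ = 1 := by omega
    rcases hj₁ with rfl | rfl
    · rw [hd0, hd2] at hmv
      omega
    · have := hhull 0 (by norm_num) h00
      rw [hd0, hd1, hd2] at this
      omega

/-! ### ρ2′ = `(Y² − 17x)² − x·Y − x` -/

/-- the x-coefficient vector of the NOMINEE ρ2′: `c₀ = Y⁴`, `c₁ = −34Y² − Y − 1`, `c₂ = 289`. -/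
def rho2' (j : ℕ) : ℤ[X] :=
  if j = 0 then X ^ 4 else if j = 1 then C (-34) * X ^ 2 - X - C 1 else if j = 2 then C 289 else 0

/-- `: rho2' 0 = X ^ 4`. -/
theorem rho2'_zero : rho2' 0 = X ^ 4 := by simp [rho2']
/-- `: rho2' 1 = C (-34) * X ^ 2 - X - C 1`. -/
theorem rho2'_one : rho2' 1 = C (-34) * X ^ 2 - X - C 1 := by simp [rho2']
/-- `: rho2' 2 = C 289`. -/
theorem rho2'_two : rho2' 2 = C 289 := by simp [rho2']

/-- `ρ2′(x, y) = y⁴ − 34x·y² − x·y − x + 289x² = (y² − 17x)² − x·y − x`. -/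
theorem bev_rho2' (x y : ℝ) :
    bev (xPolyP 2 rho2') x y = y ^ 4 - 34 * x * y ^ 2 - x * y - x + 289 * x ^ 2 := by
  rw [bev_xPolyP]
  simp [Finset.sum_range_succ, rho2'_zero, rho2'_one, rho2'_two, map_ofNat]
  ring

/-- **ρ2′ is NOT BI-PURE** (descent-immune): `ρ2′(x, 0) = Σ_j c_j(0)·x^j = −x + 289x²` carries two monomials. -/
theorem rho2'_axisX_two_monomials : (rho2' 1).coeff 0 ≠ 0 ∧ (rho2' 2).coeff 0 ≠ 0 := by
  rw [rho2'_one, rho2'_two, coeff_sub, coeff_sub, coeff_C_mul, coeff_X_pow, coeff_X, coeff_C, coeff_C]; norm_num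

/-- **THE NOMINEE ρ2′ IS A TYPED STRATUM-ρ2 RESIDUE MEMBER at every `m₀ ≤ 2`.**  Layer table of the violating hull pair
`(c₀, c₁)`: slope `s/q = 1/2`, top weight `M = 4`; support `{(0,4), (1,2), (1,1), (1,0), (2,0)}` with weights
`4, 4, 3, 2, 4`; `f = (W² − 17)²`, `f₁ = −W`, `f₂ = −1`.  The root `β = √17 ∈ ℚ₂` (Hensel) has multiplicity `μ = 2`:
(I) fails; (C) needs `μ·s = 2 < q = 2`: false (the DIGIT CEILING); (R) needs `f'(β) ≠ 0`: false.  As for `rho2` — but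
`ρ2′(x, 0) = 289x² − x` is not a monomial. -/
theorem residue_rho2' {m₀ : ℕ} (hm : m₀ ≤ 2) : Residue m₀ 2 rho2' := by
  classical
  have hd0 : (rho2' 0).natDegree = 4 := by rw [rho2'_zero, natDegree_X_pow]
  have hd1 : (rho2' 1).natDegree = 2 := by rw [rho2'_one]; compute_degree!
  have hd2 : (rho2' 2).natDegree = 0 := by rw [rho2'_two, natDegree_C]
  have h00 : rho2' 0 ≠ 0 := by rw [rho2'_zero]; exact pow_ne_zero _ X_ne_zero
  have h11 : rho2' 1 ≠ 0 := by
    intro h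
    rw [h, natDegree_zero] at hd1
    omega
  intro hS
  have hgood : EdgeGood 2 rho2' 1 2 := by
    have := hS 0 1 (by norm_num) (by norm_num) h00 h11 (by rw [hd0, hd1]; norm_num) (by rw [hd0, hd1]; omega)
      (by
        intro j hj _
        rw [hd0, hd1]
        interval_cases j
        · rw [hd0]
        · rw [hd1]
        · rw [hd2])
    rwa [hd0, hd1] at this
  obtain ⟨M, hT, hroots⟩ := hgood
  have hS' : ∀ p ∈ ({(0, 4), (1, 2), (1, 1), (1, 0), (2, 0)} : Finset (ℕ × ℕ)), p.1 ≤ 2 := by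
    intro p hp
    simp only [Finset.mem_insert, Finset.mem_singleton] at hp
    rcases hp with rfl | rfl | rfl | rfl | rfl <;> norm_num
  have hc1 : ∀ i, (rho2' 1).coeff i = (if i = 2 then -34 else 0) - (if 1 = i then 1 else 0) - (if i = 0 then 1 else 0) := by
    intro i
    rw [rho2'_one, coeff_sub, coeff_sub, coeff_C_mul, coeff_X_pow, coeff_X, coeff_C]
    split_ifs <;> ring
  have hsupp : ∀ p : ℕ × ℕ, p.1 ≤ 2 → (rho2' p.1).coeff p.2 ≠ 0 →
      p ∈ ({(0, 4), (1, 2), (1, 1), (1, 0), (2, 0)} : Finset (ℕ × ℕ)) := by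
    rintro ⟨j, i⟩ hj hc
    dsimp only at hj hc
    simp only [Finset.mem_insert, Finset.mem_singleton, Prod.mk.injEq]
    interval_cases j
    · rw [rho2'_zero, coeff_X_pow] at hc
      split_ifs at hc with h4
      · exact Or.inl ⟨rfl, h4⟩
      · exact (hc rfl).elim
    · by_cases h2 : i = 2
      · exact Or.inr (Or.inl ⟨rfl, h2⟩)
      by_cases h1 : i = 1
      · exact Or.inr (Or.inr (Or.inl ⟨rfl, h1⟩))
      by_cases h0 : i = 0
      · exact Or.inr (Or.inr (Or.inr (Or.inl ⟨rfl, h0⟩)))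
      exfalso; apply hc
      rw [hc1 i, if_neg h2, if_neg (Ne.symm h1), if_neg h0]; ring
    · rw [rho2'_two, coeff_C] at hc
      split_ifs at hc with h0
      · exact Or.inr (Or.inr (Or.inr (Or.inr ⟨rfl, h0⟩)))
      · exact (hc rfl).elim
  have h4 : 4 ≤ M := by
    have := hT.1 (0, 4) (mem_supp_of (by norm_num) (by rw [rho2'_zero, coeff_X_pow, if_pos rfl]; norm_num))
    omega
  have hM : M = 4 := by
    by_contra hne
    apply hT.2
    rw [layerPoly_eq_sum 2 rho2' _ hS' hsupp, Finset.sum_eq_zero]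
    intro p hp
    exfalso
    rw [Finset.mem_filter] at hp
    obtain ⟨hp1, hp2⟩ := hp
    simp only [Finset.mem_insert, Finset.mem_singleton] at hp1
    rcases hp1 with rfl | rfl | rfl | rfl | rfl <;> norm_num at hp2 <;> omega
  subst hM
  have h04 : (rho2' 0).coeff 4 = 1 := by rw [rho2'_zero, coeff_X_pow, if_pos rfl]
  have h12 : (rho2' 1).coeff 2 = -34 := by rw [hc1]; norm_num
  have h20 : (rho2' 2).coeff 0 = 289 := by rw [rho2'_two, coeff_C, if_pos rfl]
  have hf0 : layerPoly 2 rho2' 1 2 4 0 = X ^ 4 + C (-34) * X ^ 2 + C 289 := by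
    rw [layerPoly_eq_sum 2 rho2' _ hS' hsupp, Finset.sum_filter, Finset.sum_insert (by decide),
      Finset.sum_insert (by decide), Finset.sum_insert (by decide), Finset.sum_insert (by decide),
      Finset.sum_singleton]
    norm_num [h04, h12, h20]
    ring
  -- the root `β = √17 ∈ ℚ₂`, of multiplicity two
  obtain ⟨y, hy⟩ := exists_sqrt_seventeen
  have hβ2 : (algebraMap ℚ_[2] (PadicAlgCl 2) y) ^ 2 = 17 := by rw [← map_pow, hy, map_ofNat]
  have hβ0 : algebraMap ℚ_[2] (PadicAlgCl 2) y ≠ 0 := by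
    intro h
    rw [h, zero_pow two_ne_zero] at hβ2
    norm_num at hβ2
  have hβ4 : (algebraMap ℚ_[2] (PadicAlgCl 2) y) ^ 4 = 289 := by
    rw [show (4 : ℕ) = 2 * 2 by norm_num, pow_mul, hβ2]; norm_num
  have hroot : aeval (algebraMap ℚ_[2] (PadicAlgCl 2) y) (layerPoly 2 rho2' 1 2 4 0) = 0 := by
    rw [hf0, map_add, map_add, map_mul, map_pow, map_pow, aeval_X, aeval_C, aeval_C, eq_intCast, eq_intCast,
      hβ4, hβ2]
    norm_num
  rcases hroots _ hβ0 hroot with hirr | ⟨L, -, -, hμq⟩ | ⟨hder, -⟩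
  · exact hirr y rfl
  · -- (C): the multiplicity is `2`, and `2·1 < 2` is false
    have hμ : 2 ≤ rootMult (layerPoly 2 rho2' 1 2 4 0) (algebraMap ℚ_[2] (PadicAlgCl 2) y) := by
      unfold rootMult
      rw [le_rootMultiplicity_iff ((Polynomial.map_ne_zero_iff (RingHom.injective_int _)).mpr hT.2)]
      refine ⟨(X + C (algebraMap ℚ_[2] (PadicAlgCl 2) y)) ^ 2, ?_⟩
      have hmap : (layerPoly 2 rho2' 1 2 4 0).map (algebraMap ℤ (PadicAlgCl 2)) =
          ((X : (PadicAlgCl 2)[X]) ^ 2 - C (17 : PadicAlgCl 2)) ^ 2 := by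
        rw [hf0, Polynomial.map_add, Polynomial.map_add, Polynomial.map_mul, Polynomial.map_pow,
          Polynomial.map_pow, map_X, map_C, map_C, eq_intCast, eq_intCast]
        have h1 : ((-34 : ℤ) : PadicAlgCl 2) = -(17 + 17) := by norm_num
        have h2 : ((289 : ℤ) : PadicAlgCl 2) = 17 * 17 := by norm_num
        rw [h1, h2, map_neg, map_add, map_mul]
        ring
      have hC2 : (C (algebraMap ℚ_[2] (PadicAlgCl 2) y)) ^ 2 = C (17 : PadicAlgCl 2) := by
        rw [← map_pow, hβ2]
      have e : ((X : (PadicAlgCl 2)[X]) - C (algebraMap ℚ_[2] (PadicAlgCl 2) y)) ^ 2 *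
          (X + C (algebraMap ℚ_[2] (PadicAlgCl 2) y)) ^ 2 =
          (X ^ 2 - (C (algebraMap ℚ_[2] (PadicAlgCl 2) y)) ^ 2) ^ 2 := by
        ring
      rw [hmap, e, hC2]
    omega
  · -- (R): `f'(β) = 4β³ − 68β = 4β(β² − 17) = 0`
    apply hder
    have hd : derivative (X ^ 4 + C (-34) * X ^ 2 + C 289 : ℤ[X]) = C 4 * X ^ 3 + C (-68) * X := by
      rw [derivative_add, derivative_add, derivative_X_pow, derivative_C_mul_X_pow, derivative_C, add_zero]
      norm_num
    rw [hf0, hd, map_add, map_mul, map_mul, map_pow, aeval_X, aeval_C, aeval_C, eq_intCast, eq_intCast]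
    push_cast
    linear_combination (4 * algebraMap ℚ_[2] (PadicAlgCl 2) y) * hβ2

/-- at `m₀ ≥ 3` ρ2′ has no violating hull pair (slopes `1/2`, `1/2`, `2/4`): the sector condition holds (vacuously);
the same statement holds for `rho2` (not typed in node 27). -/
theorem sectorCond_rho2' {m₀ : ℕ} (hm : 3 ≤ m₀) : SectorCond m₀ 2 rho2' := by
  have hd0 : (rho2' 0).natDegree = 4 := by rw [rho2'_zero, natDegree_X_pow]
  have hd1 : (rho2' 1).natDegree = 2 := by rw [rho2'_one]; compute_degree!
  have hd2 : (rho2' 2).natDegree = 0 := by rw [rho2'_two, natDegree_C]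
  intro j₁ j₂ hlt hle h1 h2 hdlt hmv hhull
  have hj₂ : j₂ = 1 ∨ j₂ = 2 := by omega
  rcases hj₂ with rfl | rfl
  · obtain rfl : j₁ = 0 := by omega
    rw [hd0, hd1] at hmv
    omega
  · have hj₁ : j₁ = 0 ∨ j₁ = 1 := by omega
    rcases hj₁ with rfl | rfl
    · rw [hd0, hd2] at hmv
      omega
    · rw [hd1, hd2] at hmv
      omega

/-- **THE NOMINEES AT A GLANCE** (for the census «exhibits» line): both are typed `Residue 2` members, the complement
`SectorCond m₀` holds for `m₀ ≥ 3`, and neither is bi-pure. -/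
theorem nominees : (Residue 2 2 rho1' ∧ ∀ m₀, 3 ≤ m₀ → SectorCond m₀ 2 rho1') ∧
    (Residue 2 2 rho2' ∧ ∀ m₀, 3 ≤ m₀ → SectorCond m₀ 2 rho2') ∧
    ((rho1' 0).coeff 4 ≠ 0 ∧ (rho1' 0).coeff 3 ≠ 0) ∧ ((rho2' 1).coeff 0 ≠ 0 ∧ (rho2' 2).coeff 0 ≠ 0) :=
  ⟨⟨residue_rho1' le_rfl, fun _ h => sectorCond_rho1' h⟩, ⟨residue_rho2' le_rfl, fun _ h => sectorCond_rho2' h⟩,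
    rho1'_axisY_two_monomials, rho2'_axisX_two_monomials⟩

end Summit.Schanuel.Schanuel.Theorems.RootDecomp1KResidueDescent
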